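/-
Copyright: the b2b-balaban T⁴-continuum CRUX team, row NE7b OWNER lineage `t4-ne7b-p1` (gen 130). Project licence.
-/
import Summits.QuantumFields.BalabanUV.T4Continuum.Spine.NE7b.SupTiltedSingleSiteMoments

/-!
# LOCALITY AND SINGLE-SITE MOMENTS FOR EVERY SUP-SMALL REGULATED FAMILY: (315)'s one-site free-energy locality and (323)'s Gaussian
# exponential moment of one site under the tilted law hold for ANY measurable remainder family that is STABLE (`−κ₀t² ≤ w`) and SUP-SMALL
# on small fields (`|w_x(t)| ≤ b` for `|t| ≤ h`) — not only for the cubic ones: the one-site perturbation `w − s1_yw'` (`|w'| ≤ c₂t²`,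
# `|s| ≤ 1`) is stable with `κ₀ + c₂` and sup-small with `b + c₂h²`, hence regulated with `ε̃ = max(e^{v(b+c₂h²)}−1, 2e^{−(κ∕2−κ₀−c₂)h²})`, so
#   `|log Z(w − s1_yw') − log Z(w)| ≤ 2(Δ+1)2e·ε̃_ΨA_τ^v`   and   `⟨e^{δ₀(ω_y+ψ₀,y)²}⟩_{ν_w} ≤ exp(2(Δ+1)2e·ε̃_ΨA_τ^v)`
# uniformly in the volume — in particular for the two-site perturbed families `w − s1_yF − t1_zG` of (326) (stable `κ₀+2c₂`, sup-small
# `c₃h³+2c₂h²`), whose tilted laws carry the cumulants of SCOPING-d4 (row NE7b, node U5c; (314)∕(315)∕(323) BY NAME, re-run with the sup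
# letter; [folklore])

Cell `pub-balaban`, sub-cell `t4`, spine estimate NE7b (`T4WeightBudget.RelWeightBound`; the cell's OWN estimate — NOT PRINTED in
[Bałaban 1983–89], NOT PROVED).  Crux-route work under `Spine/NE7b/` by the row OWNER (`t4-ne7b-p1` gen 130, file (329)) under FREEZE
(0)'s crux-prover clause, on § [NE7bP1-G129-HANDOFF] NEXT (i)∕(ii) (SCOPING-d4: the moment letters `m_X` of (331) under the tilted law of a
PERTURBED family); NOTHING of Bałaban's is named as a Lean object, valued or asserted; no `T4Continuum/Support` leaf typed; no `def`, no
notation; zero `sorry`.  Imports (BY NAME): the OWNER's (323) `…SupTiltedSingleSiteMoments` (`abs_cube_le_mul_exp_sq`) and through it (315)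
(the bridge lemmas `shifted_exp_pertLogZ_on`, `pertZ_road_shift_eq`, `pertLogZ_cutoff`, `cellActivity_cutoff_of_subset`, `cutoff_shifted_regulated`,
`norm_cellActivity_le_of_regulated`, `road_factor_measurable`, `re_eq_log_of_exp_eq`, `act_norm_pertLogZ_sub_le_of_agree`), (314)
(`supSmall_factor_norm_le`, `supSmall_eps_nonneg`, `abs_tilted_mean_le`, `oneSite_measurable`, `oneSite_stable`, `oneSite_cellSum`), (313)
(`mul_opBound_le_of_le`), (306), (297).

WHAT IS PROVED ([folklore]; road data as in (315) with the cubic letter replaced by the sup letter `|w_x(t)| ≤ b` on `|t| ≤ h`):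
* §1 `oneSite_supSmall_of_supSmall` (`|w − s1_yw'| ≤ b + |s|c₂h²` on small fields), **`supSmall_perturbed_regulated`** (`|s| ≤ 1`:
  the perturbed factors are `ε̃`-regulated), **`abs_log_perturbed_sub_le_of_supSmall`** ((315)'s locality with the sup letter);
* §2 **`tilted_expSq_le_of_supSmall`**, **`tilted_mean_le_of_supSmall`**, `tilted_abs_cube_le_of_supSmall`
  ((323)'s single-site moments with the sup letter); §3 toy.

HONEST (what this is NOT).  A re-run of (315)∕(323) under a weaker letter, no new idea; the small-field step only; scalar skeleton ((A3),
NC-NE7b-α UNRULED); nothing of Bałaban's asserted.  BY-NAME EFFECT ON THE WALL: NONE.  NE7b NOT PRINTED ∕ NOT PROVED; spine PROVED 0∕9; rung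
(B)+1 — the programme's measures remain FINITE-torus statements; NOT the mass gap, NOT Clay.  HONEST DEPENDENCY: continuum YM on T⁴ ⇐
BetaPertH ∧ nine spine estimates (0∕9 proved); BetaPertH ⇐ (D1) ∧ (D4) ∧ CAP+tail; G-an2-4 gates asym, D1 and NE2∕3∕4.
-/

set_option autoImplicit false

noncomputable section

namespace Summit.QuantumFields.BalabanUV.T4Continuum.NE7b.SupRegulatedTiltedMoments

open MeasureTheory ProbabilityTheory Finset Real
open scoped BigOperators
open Literature.Probability.LatticeModels (IsRConnected pertZ cellActivity pertLogZ symm_of_inst)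
open Literature.Analysis.Matrix (HasFiniteRange)
open SupOneSitePerturbation (abs_tilted_mean_le supSmall_factor_norm_le supSmall_eps_nonneg oneSite_measurable oneSite_stable
  oneSite_cellSum)
open SupEffectiveActionLocality (act_norm_pertLogZ_sub_le_of_agree re_eq_log_of_exp_eq)
open SupSmallFieldGasReal (shifted_exp_pertLogZ_on pertZ_road_shift_eq measurable_cellSum cellSum_eq_sum_biUnion)
open SupLocalisedPolymerGas (pertLogZ_cutoff cellActivity_cutoff_of_subset cutoff_shifted_regulated)
open SupRoadFactorRegulated (road_factor_measurable)
open SupRegulatedActivityBound (norm_cellActivity_le_of_regulated)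
open SupEffectiveActionDerivative (mul_opBound_le_of_le)
open SupFluctuationAPriori (integrable_exp_neg)

variable {ι : Type} [Fintype ι] [DecidableEq ι] {V : Type*} [DecidableEq V]

/-! ## §1. The sup letter: perturbed families are regulated; locality of the free energy -/

omit [Fintype ι] [DecidableEq V] in
/-- **Sup-smallness of the one-site perturbed family from a SUP letter**: `|w_x(t)| ≤ b` on `|t| ≤ h`, `|w'| ≤ c₂t²`, `0 ≤ c₂` ⟹
`|w_x(t) − s·1_{x=y}w'_x(t)| ≤ b + |s|c₂h²` on `|t| ≤ h`. [folklore] -/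
theorem oneSite_supSmall_of_supSmall (w w' : ι → ℝ → ℝ) (y : ι) (s : ℝ) {b c₂ h : ℝ} (hc₂ : 0 ≤ c₂)
    (hsup : ∀ x, ∀ t : ℝ, |t| ≤ h → |w x t| ≤ b) (hw'q : ∀ x t, |w' x t| ≤ c₂ * t ^ 2) (x : ι) (t : ℝ) (ht : |t| ≤ h) :
    |w x t - s * (if x = y then w' x t else 0)| ≤ b + |s| * c₂ * h ^ 2 := by
  have h1 := hsup x t ht
  have ht2 : t ^ 2 ≤ h ^ 2 := by rw [← sq_abs t]; exact pow_le_pow_left₀ (abs_nonneg t) ht 2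
  have h2 : |s * (if x = y then w' x t else 0)| ≤ |s| * c₂ * h ^ 2 := by
    rw [abs_mul, mul_assoc]
    refine mul_le_mul_of_nonneg_left ?_ (abs_nonneg s)
    split_ifs
    · exact (hw'q x t).trans (mul_le_mul_of_nonneg_left ht2 hc₂)
    · rw [abs_zero]; positivity
  calc |w x t - s * (if x = y then w' x t else 0)| ≤ |w x t| + |s * (if x = y then w' x t else 0)| := abs_sub _ _
    _ ≤ b + |s| * c₂ * h ^ 2 := add_le_add h1 h2

section Main

variable {Γ : Matrix ι ι ℝ} {γop γ : ℝ} {dι : ι → ι → ℕ} {ρ : ℕ} {cell : V → Finset ι} {v : ℕ} {R : V → V → Prop}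
  [DecidableRel R] [Std.Symm R] {nbr : V → Finset V} {Δ : ℕ} {w w' : ι → ℝ → ℝ} {κ₀ κ₁ c₂ b h κ τ θ Ψ δ₀ : ℝ}

omit [Fintype ι] [DecidableEq V] [DecidableRel R] [Std.Symm R] in
/-- **Both `w` and its one-site perturbation `w − s·1_yw'` (`|s| ≤ 1`) are regulated with the SAME constant**
`ε̃ = max(e^{v(b+c₂h²)}−1, 2e^{−(κ∕2−κ₀−c₂)h²})` (`2(κ₀+c₂) ≤ κ`). [folklore] -/
theorem supSmall_perturbed_regulated (hv : ∀ p, (cell p).card ≤ v) (hκ₀ : 0 ≤ κ₀) (hc₂ : 0 ≤ c₂) (hb : 0 ≤ b) (hh : 0 ≤ h)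
    (hstab : ∀ x, ∀ t : ℝ, -(κ₀ * t ^ 2) ≤ w x t) (hsup : ∀ x, ∀ t : ℝ, |t| ≤ h → |w x t| ≤ b)
    (hw'q : ∀ x t, |w' x t| ≤ c₂ * t ^ 2) (hκ : 2 * (κ₀ + c₂) ≤ κ) (y : ι) {s : ℝ} (hs : |s| ≤ 1) (p : V) (ω : EuclideanSpace ℝ ι) :
    ‖(((exp (-(∑ x ∈ cell p, (w x (ω x) - s * (if x = y then w' x (ω x) else 0)))) - 1 : ℝ)) : ℂ)‖ ≤
      max (exp (v * (b + c₂ * h ^ 2)) - 1) (2 * exp (-((κ / 2 - (κ₀ + c₂)) * h ^ 2))) * exp (κ * (∑ x ∈ cell p, ω x ^ 2) / 2) := by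
  have hstab' : ∀ x, ∀ t : ℝ, -((κ₀ + c₂) * t ^ 2) ≤ w x t - s * (if x = y then w' x t else 0) := fun x t => by
    have h1 := oneSite_stable w w' y s hstab hw'q x t
    have h2 : 0 ≤ c₂ * (1 - |s|) * t ^ 2 := mul_nonneg (mul_nonneg hc₂ (by linarith)) (sq_nonneg t)
    nlinarith
  have hsup' : ∀ x, ∀ t : ℝ, |t| ≤ h → |w x t - s * (if x = y then w' x t else 0)| ≤ b + c₂ * h ^ 2 := fun x t ht => by
    have h1 := oneSite_supSmall_of_supSmall w w' y s hc₂ hsup hw'q x t ht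
    have h2 : 0 ≤ c₂ * (1 - |s|) * h ^ 2 := mul_nonneg (mul_nonneg hc₂ (by linarith)) (sq_nonneg h)
    nlinarith
  exact supSmall_factor_norm_le cell hv (fun x t => w x t - s * (if x = y then w' x t else 0)) (by positivity) (by positivity) hh
    hstab' hsup' hκ p ω


/-- **THE FREE ENERGY MOVES BY `O(ε)` UNDER A ONE-SITE PERTURBATION OF THE REMAINDER.**  `Γ ⪰ 0` of range `ρ`, `Γ ⪯ γ_op·1`, diagonal
`≤ γ` (`γ ≥ 0`); disjoint cells of `≤ v` sites; `R` symmetric covering `ρ`-closeness with `≤ Δ` neighbours; measurable `w, w'` with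
`−κ₀t² ≤ w`, `|w| ≤ b` on `|t| ≤ h`, `|w'| ≤ c₂t²`; `2(κ₀+c₂) ≤ κ`, `κ(1+τ)γ_op ≤ θ < 1`; `ψ₀` small on the cells of `S`; `y ∈ cell p₀`;
`|s| ≤ 1`; `e·ε̃_ΨA_τ^v(Δ+1)² ≤ 1∕2` ⟹
`|log ∫e^{−Σ_{p∈S}Σ_{cell p}(w − s1_yw')(ω+ψ₀)}dN(0,Γ) − log ∫e^{−Σ_{p∈S}Σ_{cell p}w(ω+ψ₀)}dN(0,Γ)| ≤ 2·(Δ+1)·2e·ε̃_ΨA_τ^v`. [folklore] -/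
theorem abs_log_perturbed_sub_le_of_supSmall (hΓ : Γ.PosSemidef) (hΓop : (γop • (1 : Matrix ι ι ℝ) - Γ).PosSemidef) (hdiag : ∀ i, Γ i i ≤ γ)
    (hγ : 0 ≤ γ) (hfr : HasFiniteRange dι ρ Γ) (hdisj : ∀ p q, p ≠ q → Disjoint (cell p) (cell q)) (hv : ∀ p, (cell p).card ≤ v)
    (hR : ∀ (p p' : V) (x y : ι), x ∈ cell p → y ∈ cell p' → dι x y ≤ ρ → p = p' ∨ R p p')
    (hΔ : ∀ x, (nbr x).card ≤ Δ) (hnbr : ∀ x y, R x y → y ∈ nbr x) (hw : ∀ x, Measurable (w x)) (hw'm : ∀ x, Measurable (w' x))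
    (hκ₀ : 0 ≤ κ₀) (hc₂ : 0 ≤ c₂) (hb : 0 ≤ b) (hh : 0 ≤ h) (hstab : ∀ x, ∀ t : ℝ, -(κ₀ * t ^ 2) ≤ w x t)
    (hsup : ∀ x, ∀ t : ℝ, |t| ≤ h → |w x t| ≤ b) (hw'q : ∀ x t, |w' x t| ≤ c₂ * t ^ 2) (hκ : 2 * (κ₀ + c₂) ≤ κ)
    (hτ : 0 < τ) (hθ0 : 0 < θ) (hθ1 : θ < 1) (hκθ : κ * (1 + τ) * γop ≤ θ) (S : Finset V) (ψ₀ : EuclideanSpace ℝ ι)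
    (hψ : ∀ p ∈ S, ∑ x ∈ cell p, ψ₀ x ^ 2 ≤ Ψ ^ 2) {p₀ : V} {y : ι} (hy : y ∈ cell p₀) {s : ℝ} (hs : |s| ≤ 1)
    (hsmall : Real.exp 1 * (((max (exp (v * (b + c₂ * h ^ 2)) - 1) (2 * exp (-((κ / 2 - (κ₀ + c₂)) * h ^ 2)))) *
      exp (κ * (1 + τ⁻¹) * Ψ ^ 2 / 2)) * ((1 - θ) ^ (-(κ * (1 + τ) * γ / (2 * θ)))) ^ v) * ((Δ : ℝ) + 1) ^ 2 ≤ 1 / 2) :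
    |log (∫ ω : EuclideanSpace ℝ ι, exp (-(∑ p ∈ S, ∑ x ∈ cell p,
        (w x (ω x + ψ₀ x) - s * (if x = y then w' x (ω x + ψ₀ x) else 0)))) ∂(multivariateGaussian 0 Γ)) -
      log (∫ ω : EuclideanSpace ℝ ι, exp (-(∑ p ∈ S, ∑ x ∈ cell p, w x (ω x + ψ₀ x))) ∂(multivariateGaussian 0 Γ))| ≤
      2 * ((1 : ℝ) * ((Δ : ℝ) + 1) * (2 * (Real.exp 1 * (((max (exp (v * (b + c₂ * h ^ 2)) - 1)
        (2 * exp (-((κ / 2 - (κ₀ + c₂)) * h ^ 2)))) * exp (κ * (1 + τ⁻¹) * Ψ ^ 2 / 2)) * ((1 - θ) ^ (-(κ * (1 + τ) * γ / (2 * θ)))) ^ v)))) := by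
  set μ := multivariateGaussian 0 Γ with hμ
  -- the two remainder families, `u 1 = w̃` (perturbed) and `u 0 = w`, handled uniformly through the parameter `r ∈ {s, 0}`
  set wt : ℝ → ι → ℝ → ℝ := fun r x t => w x t - r * (if x = y then w' x t else 0) with hwt
  set ε : ℝ := max (exp (v * (b + c₂ * h ^ 2)) - 1) (2 * exp (-((κ / 2 - (κ₀ + c₂)) * h ^ 2))) with hε
  have hε0 : 0 ≤ ε := supSmall_eps_nonneg v _ h κ _
  have hκ' : 0 ≤ κ := by linarith
  have hκτ : 0 ≤ κ * (1 + τ) := mul_nonneg hκ' (by linarith)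
  have h1θ : 0 < 1 - θ := by linarith
  -- the generic facts for `r` with `|r| ≤ 1`
  have hreg : ∀ r : ℝ, |r| ≤ 1 → ∀ p (ω : EuclideanSpace ℝ ι),
      ‖(((exp (-(∑ x ∈ cell p, wt r x (ω x))) - 1 : ℝ)) : ℂ)‖ ≤ ε * exp (κ * (∑ x ∈ cell p, ω x ^ 2) / 2) :=
    fun r hr p ω => supSmall_perturbed_regulated hv hκ₀ hc₂ hb hh hstab hsup hw'q hκ y hr p ω
  have hmeas : ∀ r : ℝ, ∀ p, Measurable[MeasurableSpace.comap (fun (ω : EuclideanSpace ℝ ι) (x : cell p) => ω x) inferInstance]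
      (fun ω : EuclideanSpace ℝ ι => (((exp (-(∑ x ∈ cell p, wt r x (ω x))) - 1 : ℝ)) : ℂ)) :=
    fun r p => road_factor_measurable cell (wt r) (fun x => oneSite_measurable w w' y r hw hw'm x) p
  -- real logarithm = real part of the KP logarithm, for each family
  have hreal : ∀ r : ℝ, |r| ≤ 1 →
      (pertLogZ μ (fun p ω => (((exp (-(∑ x ∈ cell p, wt r x ((ω + ψ₀) x))) - 1 : ℝ)) : ℂ)) R S).re =
        log (∫ ω : EuclideanSpace ℝ ι, exp (-(∑ p ∈ S, ∑ x ∈ cell p, wt r x (ω x + ψ₀ x))) ∂μ) := by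
    intro r hr
    have hexp := shifted_exp_pertLogZ_on hΓ hΓop hdiag hγ hfr cell hdisj hv hR hΔ hnbr hε0 hκ' hτ hθ0 hθ1 hκθ S
      (g := fun p ω => (((exp (-(∑ x ∈ cell p, wt r x (ω x))) - 1 : ℝ)) : ℂ))
      (fun p _ => hmeas r p) (fun p _ ω => hreg r hr p ω) ψ₀ hψ hsmall
    have hZ := pertZ_road_shift_eq μ cell (wt r) S ψ₀
    rw [hZ] at hexp
    have hne : pertZ μ (fun p ω => (((exp (-(∑ x ∈ cell p, wt r x ((ω + ψ₀) x))) - 1 : ℝ)) : ℂ)) S ≠ 0 := by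
      rw [hZ, ← hexp]; exact Complex.exp_ne_zero _
    have hr0 : 0 ≤ ∫ ω : EuclideanSpace ℝ ι, exp (-(∑ p ∈ S, ∑ x ∈ cell p, wt r x (ω x + ψ₀ x))) ∂μ :=
      integral_nonneg fun ω => (exp_pos _).le
    have hpos : 0 < ∫ ω : EuclideanSpace ℝ ι, exp (-(∑ p ∈ S, ∑ x ∈ cell p, wt r x (ω x + ψ₀ x))) ∂μ := by
      refine lt_of_le_of_ne hr0 fun h0 => hne ?_
      rw [hZ, ← h0, Complex.ofReal_zero]
    exact re_eq_log_of_exp_eq hpos hexp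
  have hs0 : |(0 : ℝ)| ≤ 1 := by rw [abs_zero]; exact zero_le_one
  have hw0 : ∀ x t, wt 0 x t = w x t := fun x t => by simp [hwt]
  -- rewrite both logarithms as real parts
  have hlhs : log (∫ ω : EuclideanSpace ℝ ι, exp (-(∑ p ∈ S, ∑ x ∈ cell p, w x (ω x + ψ₀ x))) ∂μ) =
      (pertLogZ μ (fun p ω => (((exp (-(∑ x ∈ cell p, wt 0 x ((ω + ψ₀) x))) - 1 : ℝ)) : ℂ)) R S).re := by
    rw [hreal 0 hs0]; simp only [hw0]
  rw [show (fun ω : EuclideanSpace ℝ ι => exp (-(∑ p ∈ S, ∑ x ∈ cell p,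
      (w x (ω x + ψ₀ x) - s * (if x = y then w' x (ω x + ψ₀ x) else 0))))) =
      fun ω => exp (-(∑ p ∈ S, ∑ x ∈ cell p, wt s x (ω x + ψ₀ x))) from rfl, ← hreal s hs, hlhs, ← Complex.sub_re]
  refine (Complex.abs_re_le_norm _).trans ?_
  -- localise to `S` and apply the activity-level locality with `D = {p₀}`
  rw [← pertLogZ_cutoff μ (fun p ω => (((exp (-(∑ x ∈ cell p, wt s x ((ω + ψ₀) x))) - 1 : ℝ)) : ℂ)) R S,
    ← pertLogZ_cutoff μ (fun p ω => (((exp (-(∑ x ∈ cell p, wt 0 x ((ω + ψ₀) x))) - 1 : ℝ)) : ℂ)) R S]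
  have hA0 : 0 ≤ (ε * exp (κ * (1 + τ⁻¹) * Ψ ^ 2 / 2)) * ((1 - θ) ^ (-(κ * (1 + τ) * γ / (2 * θ)))) ^ v :=
    mul_nonneg (mul_nonneg hε0 (exp_pos _).le) (pow_nonneg (rpow_pos_of_pos h1θ _).le _)
  have hact : ∀ r : ℝ, |r| ≤ 1 → ∀ K : Finset V, IsRConnected R K →
      ‖cellActivity μ (fun p ω => if p ∈ S then
        (fun p ω => (((exp (-(∑ x ∈ cell p, wt r x (ω x))) - 1 : ℝ)) : ℂ)) p (ω + ψ₀) else 0) K‖ ≤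
        ((ε * exp (κ * (1 + τ⁻¹) * Ψ ^ 2 / 2)) * ((1 - θ) ^ (-(κ * (1 + τ) * γ / (2 * θ)))) ^ v) ^ K.card :=
    fun r hr K _ => norm_cellActivity_le_of_regulated hΓ hΓop hdiag hγ cell hdisj hv (mul_nonneg hε0 (exp_pos _).le) hκτ hθ0 hθ1 hκθ
      (cutoff_shifted_regulated cell hε0 hκ' hτ S (fun p _ ω => hreg r hr p ω) ψ₀ hψ) K
  have key := act_norm_pertLogZ_sub_le_of_agree symm_of_inst hΔ hnbr (hact s hs) (hact 0 hs0) hA0 hsmall S {p₀} (fun K hKS hKD => by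
    rw [cellActivity_cutoff_of_subset μ _ hKS, cellActivity_cutoff_of_subset μ _ hKS]
    -- on cells other than `p₀` the two families coincide pointwise
    unfold cellActivity
    refine integral_congr_ae (ae_of_all _ fun ω => prod_congr rfl fun p hp => ?_)
    have hpp : p ≠ p₀ := fun h0 => Finset.disjoint_left.1 hKD hp (by rw [h0]; exact mem_singleton_self _)
    have hsum : ∑ x ∈ cell p, wt s x ((ω + ψ₀) x) = ∑ x ∈ cell p, wt 0 x ((ω + ψ₀) x) := by
      refine sum_congr rfl fun x hx => ?_
      have hxy : x ≠ y := fun h0 => Finset.disjoint_left.1 (hdisj p p₀ hpp) hx (h0 ▸ hy)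
      simp [hwt, hxy]
    simp only [hsum])
  rw [card_singleton, Nat.cast_one] at key
  exact key


/-! ## §2. Single-site moments under the tilted law of a sup-small family -/

/-- **THE GAUSSIAN EXPONENTIAL MOMENT OF ONE SITE UNDER THE TILTED LAW OF A SUP-SMALL FAMILY IS `O(1)` UNIFORMLY IN THE VOLUME.**  `Γ ⪰ 0` of range `ρ`,
`Γ ⪯ γ_op·1`, diagonal `≤ γ` (`γ ≥ 0`); disjoint cells of `≤ v` sites; `R` symmetric covering `ρ`-closeness with `≤ Δ` neighbours; measurable
`w` with `−κ₀t² ≤ w`, `|w| ≤ b` on `|t| ≤ h`; `0 ≤ δ₀`, `2(κ₀+δ₀) ≤ κ`, `κ(1+τ)γ_op ≤ θ < 1`; `ψ₀` small on the cells of `S`;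
`y ∈ cell p₀`, `p₀ ∈ S`; `e·ε̃_ΨA_τ^v(Δ+1)² ≤ ½` with `ε̃ = max(e^{v(b+δ₀h²)}−1, 2e^{−(κ∕2−(κ₀+δ₀))h²})` ⟹
`(∫e^{−Σ_{p∈S}Σ_{cell p}w(ω+ψ₀)}dN(0,Γ))⁻¹·∫e^{−Σ_{p∈S}Σ_{cell p}w(ω+ψ₀)}e^{δ₀(ω_y+ψ₀,y)²}dN(0,Γ) ≤ exp(2·(Δ+1)·2e·ε̃_ΨA_τ^v)`. [folklore] -/
theorem tilted_expSq_le_of_supSmall (hΓ : Γ.PosSemidef) (hΓop : (γop • (1 : Matrix ι ι ℝ) - Γ).PosSemidef) (hdiag : ∀ i, Γ i i ≤ γ)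
    (hγ : 0 ≤ γ) (hfr : HasFiniteRange dι ρ Γ) (hdisj : ∀ p q, p ≠ q → Disjoint (cell p) (cell q)) (hv : ∀ p, (cell p).card ≤ v)
    (hR : ∀ (p p' : V) (x y : ι), x ∈ cell p → y ∈ cell p' → dι x y ≤ ρ → p = p' ∨ R p p')
    (hΔ : ∀ x, (nbr x).card ≤ Δ) (hnbr : ∀ x y, R x y → y ∈ nbr x) (hw : ∀ x, Measurable (w x))
    (hκ₀ : 0 ≤ κ₀) (hδ₀ : 0 ≤ δ₀) (hb : 0 ≤ b) (hh : 0 ≤ h) (hstab : ∀ x, ∀ t : ℝ, -(κ₀ * t ^ 2) ≤ w x t)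
    (hsup : ∀ x, ∀ t : ℝ, |t| ≤ h → |w x t| ≤ b) (hκ : 2 * (κ₀ + δ₀) ≤ κ)
    (hτ : 0 < τ) (hθ0 : 0 < θ) (hθ1 : θ < 1) (hκθ : κ * (1 + τ) * γop ≤ θ) (S : Finset V) (ψ₀ : EuclideanSpace ℝ ι)
    (hψ : ∀ p ∈ S, ∑ x ∈ cell p, ψ₀ x ^ 2 ≤ Ψ ^ 2) {p₀ : V} (hp₀ : p₀ ∈ S) {y : ι} (hy : y ∈ cell p₀)
    (hsmall : Real.exp 1 * (((max (exp (v * (b + δ₀ * h ^ 2)) - 1) (2 * exp (-((κ / 2 - (κ₀ + δ₀)) * h ^ 2)))) *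
      exp (κ * (1 + τ⁻¹) * Ψ ^ 2 / 2)) * ((1 - θ) ^ (-(κ * (1 + τ) * γ / (2 * θ)))) ^ v) * ((Δ : ℝ) + 1) ^ 2 ≤ 1 / 2) :
    (∫ ω : EuclideanSpace ℝ ι, exp (-(∑ p ∈ S, ∑ x ∈ cell p, w x (ω x + ψ₀ x))) ∂(multivariateGaussian 0 Γ))⁻¹ *
        ∫ ω : EuclideanSpace ℝ ι, exp (-(∑ p ∈ S, ∑ x ∈ cell p, w x (ω x + ψ₀ x))) * exp (δ₀ * (ω y + ψ₀ y) ^ 2)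
          ∂(multivariateGaussian 0 Γ) ≤
      exp (2 * ((1 : ℝ) * ((Δ : ℝ) + 1) * (2 * (Real.exp 1 * (((max (exp (v * (b + δ₀ * h ^ 2)) - 1)
        (2 * exp (-((κ / 2 - (κ₀ + δ₀)) * h ^ 2)))) * exp (κ * (1 + τ⁻¹) * Ψ ^ 2 / 2)) *
        ((1 - θ) ^ (-(κ * (1 + τ) * γ / (2 * θ)))) ^ v))))) := by
  set μ := multivariateGaussian 0 Γ with hμ
  -- the free-energy difference of the perturbed family `w − δ₀t²·1_y` (as `w − 1·1_y·w'` with `w'(t) = δ₀t²`, `c₂ = δ₀`)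
  have hs1 : |(1 : ℝ)| ≤ 1 := by rw [abs_one]
  have hlog := abs_log_perturbed_sub_le_of_supSmall (w' := fun _ t => δ₀ * t ^ 2) hΓ hΓop hdiag hγ hfr hdisj hv hR hΔ hnbr hw
    (fun _ => (measurable_id.pow_const 2).const_mul δ₀) hκ₀ hδ₀ hb hh hstab hsup
    (fun x t => by rw [abs_of_nonneg (by positivity : (0 : ℝ) ≤ δ₀ * t ^ 2)]) hκ hτ hθ0 hθ1 hκθ S ψ₀ hψ hy hs1 hsmall
  -- identify the perturbed partition function with the exponential-moment numerator
  have heq : ∫ ω : EuclideanSpace ℝ ι, exp (-(∑ p ∈ S, ∑ x ∈ cell p,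
      (w x (ω x + ψ₀ x) - 1 * (if x = y then δ₀ * (ω x + ψ₀ x) ^ 2 else 0)))) ∂μ =
      ∫ ω : EuclideanSpace ℝ ι, exp (-(∑ p ∈ S, ∑ x ∈ cell p, w x (ω x + ψ₀ x))) * exp (δ₀ * (ω y + ψ₀ y) ^ 2) ∂μ :=
    integral_congr_ae (ae_of_all _ fun ω => by
      simp only
      rw [oneSite_cellSum w (fun _ t => δ₀ * t ^ 2) y 1 cell hdisj S hp₀ hy (fun x => ω x) (fun x => ψ₀ x), ← exp_add]
      congr 1
      ring)
  rw [heq] at hlog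
  -- positivity of both partition functions
  have hκθ₀ : 2 * κ₀ * (1 + τ) * γop ≤ θ := by
    have := mul_opBound_le_of_le (a := 2 * κ₀ * (1 + τ)) (b := κ * (1 + τ)) (by positivity)
      (mul_le_mul_of_nonneg_right (by linarith) (by linarith)) hθ0.le (by simpa [mul_assoc] using hκθ)
    simpa [mul_assoc] using this
  have hκθ₁ : 2 * (κ₀ + δ₀) * (1 + τ) * γop ≤ θ := by
    have := mul_opBound_le_of_le (a := 2 * (κ₀ + δ₀) * (1 + τ)) (b := κ * (1 + τ)) (by positivity)
      (mul_le_mul_of_nonneg_right hκ (by linarith)) hθ0.le (by simpa [mul_assoc] using hκθ)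
    simpa [mul_assoc] using this
  have hU : Integrable (fun ω : EuclideanSpace ℝ ι => exp (-(∑ p ∈ S, ∑ x ∈ cell p, w x (ω x + ψ₀ x)))) μ := by
    have h := integrable_exp_neg hΓ hΓop (S.biUnion cell) w hw hκ₀ hτ hθ1 hκθ₀ hstab (fun x => ψ₀ x)
    refine h.congr (ae_of_all _ fun ω => ?_)
    simp only
    rw [cellSum_eq_sum_biUnion cell hdisj S]
  have hZ : 0 < ∫ ω : EuclideanSpace ℝ ι, exp (-(∑ p ∈ S, ∑ x ∈ cell p, w x (ω x + ψ₀ x))) ∂μ := integral_exp_pos hU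
  have hZ' : 0 < ∫ ω : EuclideanSpace ℝ ι, exp (-(∑ p ∈ S, ∑ x ∈ cell p, w x (ω x + ψ₀ x))) * exp (δ₀ * (ω y + ψ₀ y) ^ 2) ∂μ := by
    have hI := SupTiltedSingleSiteMoments.integrable_exp_neg_mul_expSq hΓ hΓop hdisj hw hκ₀ hδ₀ hstab hτ hθ1 hκθ₁ S ψ₀ hp₀ hy
    have hI' : Integrable (fun ω : EuclideanSpace ℝ ι => exp (-(∑ p ∈ S, ∑ x ∈ cell p, w x (ω x + ψ₀ x)) + δ₀ * (ω y + ψ₀ y) ^ 2)) μ :=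
      hI.congr (ae_of_all _ fun ω => by simp only [exp_add])
    have h := integral_exp_pos hI'
    refine h.trans_le (le_of_eq (integral_congr_ae (ae_of_all _ fun ω => ?_)))
    simp only [exp_add]
  -- the ratio is the exponential of the free-energy difference
  rw [inv_mul_eq_div, ← exp_log (div_pos hZ' hZ), log_div hZ'.ne' hZ.ne']
  exact exp_le_exp.2 ((le_abs_self _).trans hlog)

/-- **SINGLE-SITE MOMENTS UNDER THE TILTED LAW**: under the hypotheses of `tilted_expSq_le`, for every `φ` with
`0 ≤ φ(t) ≤ a·e^{δ₀t²}`: `Z⁻¹·∫e^{−V}φ(ω_y+ψ₀,y)dμ ≤ a·exp(2·(Δ+1)·2e·ε̃_ΨA_τ^v)`. [folklore] -/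
theorem tilted_mean_le_of_supSmall (hΓ : Γ.PosSemidef) (hΓop : (γop • (1 : Matrix ι ι ℝ) - Γ).PosSemidef) (hdiag : ∀ i, Γ i i ≤ γ)
    (hγ : 0 ≤ γ) (hfr : HasFiniteRange dι ρ Γ) (hdisj : ∀ p q, p ≠ q → Disjoint (cell p) (cell q)) (hv : ∀ p, (cell p).card ≤ v)
    (hR : ∀ (p p' : V) (x y : ι), x ∈ cell p → y ∈ cell p' → dι x y ≤ ρ → p = p' ∨ R p p')
    (hΔ : ∀ x, (nbr x).card ≤ Δ) (hnbr : ∀ x y, R x y → y ∈ nbr x) (hw : ∀ x, Measurable (w x))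
    (hκ₀ : 0 ≤ κ₀) (hδ₀ : 0 ≤ δ₀) (hb : 0 ≤ b) (hh : 0 ≤ h) (hstab : ∀ x, ∀ t : ℝ, -(κ₀ * t ^ 2) ≤ w x t)
    (hsup : ∀ x, ∀ t : ℝ, |t| ≤ h → |w x t| ≤ b) (hκ : 2 * (κ₀ + δ₀) ≤ κ)
    (hτ : 0 < τ) (hθ0 : 0 < θ) (hθ1 : θ < 1) (hκθ : κ * (1 + τ) * γop ≤ θ) (S : Finset V) (ψ₀ : EuclideanSpace ℝ ι)
    (hψ : ∀ p ∈ S, ∑ x ∈ cell p, ψ₀ x ^ 2 ≤ Ψ ^ 2) {p₀ : V} (hp₀ : p₀ ∈ S) {y : ι} (hy : y ∈ cell p₀)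
    (hsmall : Real.exp 1 * (((max (exp (v * (b + δ₀ * h ^ 2)) - 1) (2 * exp (-((κ / 2 - (κ₀ + δ₀)) * h ^ 2)))) *
      exp (κ * (1 + τ⁻¹) * Ψ ^ 2 / 2)) * ((1 - θ) ^ (-(κ * (1 + τ) * γ / (2 * θ)))) ^ v) * ((Δ : ℝ) + 1) ^ 2 ≤ 1 / 2)
    {φ : ℝ → ℝ} {a : ℝ} (hφ0 : ∀ t, 0 ≤ φ t) (hφ : ∀ t, φ t ≤ a * exp (δ₀ * t ^ 2)) :
    (∫ ω : EuclideanSpace ℝ ι, exp (-(∑ p ∈ S, ∑ x ∈ cell p, w x (ω x + ψ₀ x))) ∂(multivariateGaussian 0 Γ))⁻¹ *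
        ∫ ω : EuclideanSpace ℝ ι, exp (-(∑ p ∈ S, ∑ x ∈ cell p, w x (ω x + ψ₀ x))) * φ (ω y + ψ₀ y) ∂(multivariateGaussian 0 Γ) ≤
      a * exp (2 * ((1 : ℝ) * ((Δ : ℝ) + 1) * (2 * (Real.exp 1 * (((max (exp (v * (b + δ₀ * h ^ 2)) - 1)
        (2 * exp (-((κ / 2 - (κ₀ + δ₀)) * h ^ 2)))) * exp (κ * (1 + τ⁻¹) * Ψ ^ 2 / 2)) *
        ((1 - θ) ^ (-(κ * (1 + τ) * γ / (2 * θ)))) ^ v))))) := by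
  set μ := multivariateGaussian 0 Γ with hμ
  have hmain := tilted_expSq_le_of_supSmall hΓ hΓop hdiag hγ hfr hdisj hv hR hΔ hnbr hw hκ₀ hδ₀ hb hh hstab hsup hκ hτ hθ0 hθ1 hκθ S ψ₀ hψ hp₀
    hy hsmall
  have hκθ₀ : 2 * κ₀ * (1 + τ) * γop ≤ θ := by
    have := mul_opBound_le_of_le (a := 2 * κ₀ * (1 + τ)) (b := κ * (1 + τ)) (by positivity)
      (mul_le_mul_of_nonneg_right (by linarith) (by linarith)) hθ0.le (by simpa [mul_assoc] using hκθ)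
    simpa [mul_assoc] using this
  have hκθ₁ : 2 * (κ₀ + δ₀) * (1 + τ) * γop ≤ θ := by
    have := mul_opBound_le_of_le (a := 2 * (κ₀ + δ₀) * (1 + τ)) (b := κ * (1 + τ)) (by positivity)
      (mul_le_mul_of_nonneg_right hκ (by linarith)) hθ0.le (by simpa [mul_assoc] using hκθ)
    simpa [mul_assoc] using this
  have hU : Integrable (fun ω : EuclideanSpace ℝ ι => exp (-(∑ p ∈ S, ∑ x ∈ cell p, w x (ω x + ψ₀ x)))) μ := by
    have h := integrable_exp_neg hΓ hΓop (S.biUnion cell) w hw hκ₀ hτ hθ1 hκθ₀ hstab (fun x => ψ₀ x)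
    refine h.congr (ae_of_all _ fun ω => ?_)
    simp only
    rw [cellSum_eq_sum_biUnion cell hdisj S]
  have hZ : 0 < ∫ ω : EuclideanSpace ℝ ι, exp (-(∑ p ∈ S, ∑ x ∈ cell p, w x (ω x + ψ₀ x))) ∂μ := integral_exp_pos hU
  have hI := SupTiltedSingleSiteMoments.integrable_exp_neg_mul_expSq hΓ hΓop hdisj hw hκ₀ hδ₀ hstab hτ hθ1 hκθ₁ S ψ₀ hp₀ hy
  -- pointwise domination `e^{−V}φ ≤ a·e^{−V}e^{δ₀t²}`, integrated and divided by `Z`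
  have hmono : ∫ ω : EuclideanSpace ℝ ι, exp (-(∑ p ∈ S, ∑ x ∈ cell p, w x (ω x + ψ₀ x))) * φ (ω y + ψ₀ y) ∂μ ≤
      ∫ ω : EuclideanSpace ℝ ι, a * (exp (-(∑ p ∈ S, ∑ x ∈ cell p, w x (ω x + ψ₀ x))) * exp (δ₀ * (ω y + ψ₀ y) ^ 2)) ∂μ := by
    refine integral_mono_of_nonneg (ae_of_all _ fun ω => mul_nonneg (exp_pos _).le (hφ0 _)) (hI.const_mul a)
      (ae_of_all _ fun ω => ?_)
    have h := hφ (ω y + ψ₀ y)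
    have he : 0 < exp (-(∑ p ∈ S, ∑ x ∈ cell p, w x (ω x + ψ₀ x))) := exp_pos _
    nlinarith
  rw [integral_const_mul] at hmono
  calc (∫ ω : EuclideanSpace ℝ ι, exp (-(∑ p ∈ S, ∑ x ∈ cell p, w x (ω x + ψ₀ x))) ∂μ)⁻¹ *
        ∫ ω : EuclideanSpace ℝ ι, exp (-(∑ p ∈ S, ∑ x ∈ cell p, w x (ω x + ψ₀ x))) * φ (ω y + ψ₀ y) ∂μ
      ≤ (∫ ω : EuclideanSpace ℝ ι, exp (-(∑ p ∈ S, ∑ x ∈ cell p, w x (ω x + ψ₀ x))) ∂μ)⁻¹ *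
        (a * ∫ ω : EuclideanSpace ℝ ι, exp (-(∑ p ∈ S, ∑ x ∈ cell p, w x (ω x + ψ₀ x))) * exp (δ₀ * (ω y + ψ₀ y) ^ 2) ∂μ) :=
        mul_le_mul_of_nonneg_left hmono (inv_nonneg.2 hZ.le)
    _ = a * ((∫ ω : EuclideanSpace ℝ ι, exp (-(∑ p ∈ S, ∑ x ∈ cell p, w x (ω x + ψ₀ x))) ∂μ)⁻¹ *
        ∫ ω : EuclideanSpace ℝ ι, exp (-(∑ p ∈ S, ∑ x ∈ cell p, w x (ω x + ψ₀ x))) * exp (δ₀ * (ω y + ψ₀ y) ^ 2) ∂μ) := by ring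
    _ ≤ _ := by
        have ha : 0 ≤ a := by
          have h := hφ 0
          have h0 := hφ0 0
          rw [zero_pow two_ne_zero, mul_zero, exp_zero, mul_one] at h
          linarith
        exact mul_le_mul_of_nonneg_left hmain ha

/-- **THE END — THE THIRD ABSOLUTE SINGLE-SITE MOMENT OF THE TILTED LAW IS `O(1)` UNIFORMLY IN THE VOLUME**: under the hypotheses of
`tilted_expSq_le` with `0 < δ₀`: `Z⁻¹·∫e^{−V}|ω_y+ψ₀,y|³dμ ≤ (1 + 2(δ₀²)⁻¹)·exp(2·(Δ+1)·2e·ε̃_ΨA_τ^v)`. [folklore] -/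
theorem tilted_abs_cube_le_of_supSmall (hΓ : Γ.PosSemidef) (hΓop : (γop • (1 : Matrix ι ι ℝ) - Γ).PosSemidef) (hdiag : ∀ i, Γ i i ≤ γ)
    (hγ : 0 ≤ γ) (hfr : HasFiniteRange dι ρ Γ) (hdisj : ∀ p q, p ≠ q → Disjoint (cell p) (cell q)) (hv : ∀ p, (cell p).card ≤ v)
    (hR : ∀ (p p' : V) (x y : ι), x ∈ cell p → y ∈ cell p' → dι x y ≤ ρ → p = p' ∨ R p p')
    (hΔ : ∀ x, (nbr x).card ≤ Δ) (hnbr : ∀ x y, R x y → y ∈ nbr x) (hw : ∀ x, Measurable (w x))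
    (hκ₀ : 0 ≤ κ₀) (hδ₀ : 0 < δ₀) (hb : 0 ≤ b) (hh : 0 ≤ h) (hstab : ∀ x, ∀ t : ℝ, -(κ₀ * t ^ 2) ≤ w x t)
    (hsup : ∀ x, ∀ t : ℝ, |t| ≤ h → |w x t| ≤ b) (hκ : 2 * (κ₀ + δ₀) ≤ κ)
    (hτ : 0 < τ) (hθ0 : 0 < θ) (hθ1 : θ < 1) (hκθ : κ * (1 + τ) * γop ≤ θ) (S : Finset V) (ψ₀ : EuclideanSpace ℝ ι)
    (hψ : ∀ p ∈ S, ∑ x ∈ cell p, ψ₀ x ^ 2 ≤ Ψ ^ 2) {p₀ : V} (hp₀ : p₀ ∈ S) {y : ι} (hy : y ∈ cell p₀)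
    (hsmall : Real.exp 1 * (((max (exp (v * (b + δ₀ * h ^ 2)) - 1) (2 * exp (-((κ / 2 - (κ₀ + δ₀)) * h ^ 2)))) *
      exp (κ * (1 + τ⁻¹) * Ψ ^ 2 / 2)) * ((1 - θ) ^ (-(κ * (1 + τ) * γ / (2 * θ)))) ^ v) * ((Δ : ℝ) + 1) ^ 2 ≤ 1 / 2) :
    (∫ ω : EuclideanSpace ℝ ι, exp (-(∑ p ∈ S, ∑ x ∈ cell p, w x (ω x + ψ₀ x))) ∂(multivariateGaussian 0 Γ))⁻¹ *
        ∫ ω : EuclideanSpace ℝ ι, exp (-(∑ p ∈ S, ∑ x ∈ cell p, w x (ω x + ψ₀ x))) * |ω y + ψ₀ y| ^ 3 ∂(multivariateGaussian 0 Γ) ≤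
      (1 + 2 * (δ₀ ^ 2)⁻¹) * exp (2 * ((1 : ℝ) * ((Δ : ℝ) + 1) * (2 * (Real.exp 1 * (((max (exp (v * (b + δ₀ * h ^ 2)) - 1)
        (2 * exp (-((κ / 2 - (κ₀ + δ₀)) * h ^ 2)))) * exp (κ * (1 + τ⁻¹) * Ψ ^ 2 / 2)) *
        ((1 - θ) ^ (-(κ * (1 + τ) * γ / (2 * θ)))) ^ v))))) :=
  tilted_mean_le_of_supSmall hΓ hΓop hdiag hγ hfr hdisj hv hR hΔ hnbr hw hκ₀ hδ₀.le hb hh hstab hsup hκ hτ hθ0 hθ1 hκθ S ψ₀ hψ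
    hp₀ hy hsmall (φ := fun t => |t| ^ 3) (fun t => by positivity)
    (fun t => SupTiltedSingleSiteMoments.abs_cube_le_mul_exp_sq hδ₀ t)

end Main

/-! ## §3. Toy -/

/-- Toy (§1): the ZERO family with the zero profile is sup-small with `0 + |1|·0·h²`. -/
example (y x : Fin 2) (t : ℝ) (ht : |t| ≤ 1) :
    |(fun (_ : Fin 2) (_ : ℝ) => (0 : ℝ)) x t - 1 * (if x = y then (fun (_ : Fin 2) (_ : ℝ) => (0 : ℝ)) x t else 0)| ≤ 0 + |(1 : ℝ)| * 0 * 1 ^ 2 :=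
  oneSite_supSmall_of_supSmall (fun _ _ => 0) (fun _ _ => 0) y 1 le_rfl (fun _ _ _ => by simp) (fun _ _ => by simp) x t ht

end Summit.QuantumFields.BalabanUV.T4Continuum.NE7b.SupRegulatedTiltedMoments
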